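import Summits.HubbardSuperconductivity.HubbardSuperconductivity.Theorems.KacWindowPenaltyGlue
import Summits.HubbardSuperconductivity.HubbardSuperconductivity.Theorems.FunctionFieldCertificateWindowInfraredBoundReductions

/-!
# Crux `WindowGap` (stmt-HubbardSuperconductivity-1088): what a refuter must show —
# no `d`-wave order AND a Goldstone-or-softer pair structure factor in SOME ground-state sequence

The body of the crux `KacWindowPenalty.WindowGap` at a parameter point `(U, δ)` reads
`∀ C ≥ 0 ∀ ε₀ > 0 ∃ ε ∈ (0, ε₀] ∃ λ, a > 0 ∃ L₀ ∀ even L ≥ L₀: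
λ(Cε + a)L² ≤ minEnergyOn (H_L + λW_ε) K_L − minEnergyOn H_L K_L`
(`H_L = hubbardTorus 2 L 1 U`, `K_L = szSector N_L 0`, `N_L = 2⌊(1−δ)L²/2⌋`, `W_ε` the Kac-window pair
penalty). By the route's sandwich every normalised sector ground state `ψ` of the UNPENALISED `H_L`
then carries window pair weight `(Cε + a)L² ≤ Re ⟨ψ, W_ε ψ⟩ = Σ_{|q_m| ≤ ε} S_ψ(m)`
(`S_ψ(m) = pairStructureFactor dWaveFormFactor L ψ m = ‖Δ_d(m)ψ‖²/L²`). This file records the exact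
NEGATIVE interface this forces (`not_windowGapAt_of_goldstoneShape_of_noLRO`): the crux body at
`(U, δ)` is FALSE as soon as, for every order floor `s > 0`, at all large even `L` SOME normalised
sector ground state `ψ_L` has
* no `d`-wave pair order at level `s`: `Re ⟨ψ_L, Δ_dᴴ Δ_d ψ_L⟩ ≤ s L⁴` (the summit's order quantity), and
* a GOLDSTONE-OR-SOFTER pair structure factor on a fixed punctured window:
  `S_{ψ_L}(m) · |q_m| ≤ A` for `0 < |q_m| ≤ ε₁` (`A`, `ε₁` independent of `s`, `L`).
Indeed the Goldstone shape makes the window tail `≤ 32 A ε L²` (`windowSum_le_of_goldstoneShape`, the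
punctured-window lattice sum `Σ_{0<|q|≤ε} |q|⁻¹ ≍ εL²`), so testing the crux at `C := 32A + 1`,
`ε₀ := ε₁` and the order floor `s := a/2` the every-ground-state floor of the route
(`kacWindowPenalty_everyGS_floor`: gap + tail ≤ σL² ⇒ `a'L⁴ ≤ Re ⟨ψ, Δ_dᴴΔ_dψ⟩`) leaves
`(ε + a)L⁴ ≤ (a/2)L⁴`, absurd. Consequently (`not_windowGap_of_forall_goldstoneShape_noLRO`) the crux
itself is false if this holds at EVERY `U > 0`, `δ ∈ (0, 1/2)`.

Reading. `WindowGap` at `(U, δ)` therefore CONTAINS: in every sequence of sector ground states, either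
`d`-wave pair long-range order (`Re ⟨ψ, Δ_dᴴΔ_dψ⟩ ≳ L⁴`, the summit's conclusion for that sequence) or
a pair structure factor MORE singular than the Goldstone shape `1/|q|` at small nonzero momenta
(`sup_{0<|q|≤ε₁} S_ψ(q)|q| → ∞`), uniformly often in `L`. A bounded ("metallic") structure factor
`S_ψ ≤ B` on the punctured window is the special case `A = Bε₁`
(`not_windowGapAt_of_bddStructureFactor_of_noLRO`): the rigorous form of the calibration "a metal
fails the crux" of `Cruxes/WindowGap/NOTES.md` §1, conditional on the (unproved, at every `U > 0`)
metallic bounds. No parameter point is claimed: at no `(U, δ)` are these hypotheses theorems today.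
Support / negative for the crux (`--supports stmt-HubbardSuperconductivity-1088`); no definitions,
no named facts. Sources: D. J. Scalapino, Phys. Rep. 250 (1995) 329, §2 (2.4) (the order quantity);
T. Kennedy, E. H. Lieb, B. S. Shastry, PRL 61 (1988) 2582 (sum rule / infrared-bound bookkeeping,
shape `1/E(q)^{1/2}`); H. Tasaki, *Physics and Mathematics of Quantum Many-Body Systems* (2020) §2.1
(variational principle).
-/

-- the mandated namespace repeats `HubbardSuperconductivity` (single-problem summit, D-0017)
set_option linter.dupNamespace false

noncomputable section
namespace Summit.HubbardSuperconductivity.HubbardSuperconductivity.Theorems.WindowGap.Negative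

open Matrix Finset Literature.MathematicalPhysics.QuantumLattice Literature.Probability.LatticeModels
  Summit.HubbardSuperconductivity.HubbardSuperconductivity.Theorems
open Summit.HubbardSuperconductivity.HubbardSuperconductivity.Theses.KacWindowPenalty (WindowGap)

/-- **No order + Goldstone-or-softer shape in some ground-state sequence refutes the crux body at
`(U, δ)`.** Suppose `A ≥ 0`, `ε₁ > 0` and: for every `s > 0` there is `L₁` such that at every even
`L ≥ L₁` some normalised `(N_L, S^z = 0)`-sector ground state `ψ` of `hubbardTorus 2 L 1 U`
(`N_L = 2⌊(1−δ)L²/2⌋`) has `Re ⟨ψ, Δ_dᴴ Δ_d ψ⟩ ≤ s L⁴` and `S_ψ(m)·|q_m| ≤ A` for all `m ≠ 0` with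
`|q_m|² ≤ ε₁²`. Then the body of `WindowGap` at `(U, δ)` fails: at `C = 32A + 1`, `ε₀ = ε₁`, order
floor `s = a/2` and an even side `L = 2(max L₀ L₁ + 1)`, the tail bound `≤ 32AεL²`
(`windowSum_le_of_goldstoneShape`) and the every-ground-state floor (`kacWindowPenalty_everyGS_floor`)
give `(ε + a)L⁴ ≤ (a/2)L⁴`. Scalapino, Phys. Rep. 250 (1995) §2; Tasaki (2020) §2.1. [folklore] -/
theorem not_windowGapAt_of_goldstoneShape_of_noLRO {U δ A ε₁ : ℝ} (hA : 0 ≤ A) (hε₁ : 0 < ε₁)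
    (h : ∀ s : ℝ, 0 < s → ∃ L₁ : ℕ, ∀ (L : ℕ) [NeZero L], L₁ ≤ L → Even L →
      ∃ ψ : Fock (Orb (FermionTorus 2 L)), star ψ ⬝ᵥ ψ = 1 ∧
        IsGroundStateInSector (hubbardTorus 2 L 1 U) (2 * ⌊(1 - δ) * (L : ℝ) ^ 2 / 2⌋₊) 0 ψ ∧
        (expect ((pairField dWaveFormFactor L)ᴴ * pairField dWaveFormFactor L) ψ).re ≤
          s * (L : ℝ) ^ 4 ∧
        ∀ m : TorusSite 2 L, m ≠ 0 → momentumNormSq L m ≤ ε₁ ^ 2 →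
          pairStructureFactor dWaveFormFactor L ψ m * Real.sqrt (momentumNormSq L m) ≤ A) :
    ¬ ∀ C : ℝ, 0 ≤ C → ∀ ε₀ : ℝ, 0 < ε₀ → ∃ ε ∈ Set.Ioc (0 : ℝ) ε₀, ∃ lam a : ℝ, 0 < lam ∧ 0 < a ∧
      ∃ L₀ : ℕ, ∀ (L : ℕ) [NeZero L], L₀ ≤ L → Even L →
        lam * (C * ε + a) * (L : ℝ) ^ 2 ≤
          (hubbardTorus 2 L 1 U + (lam : ℂ) • (∑ m : Fin 2 → ZMod L,
              if (2 * Real.pi / (L : ℝ)) ^ 2 * (∑ i : Fin 2, (((m i).valMinAbs : ℤ) : ℝ) ^ 2) ≤ ε ^ 2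
              then ((L : ℂ) ^ 2)⁻¹ • (Matrix.conjTranspose (pairFieldAt dWaveFormFactor L m) *
                pairFieldAt dWaveFormFactor L m)
              else 0)).minEnergyOn (szSector (2 * ⌊(1 - δ) * (L : ℝ) ^ 2 / 2⌋₊) 0) -
            (hubbardTorus 2 L 1 U).minEnergyOn (szSector (2 * ⌊(1 - δ) * (L : ℝ) ^ 2 / 2⌋₊) 0) := by
  intro hWG
  -- test the crux at `C = 32A + 1`, `ε₀ = ε₁`
  obtain ⟨ε, hε, lam, a, hlam, ha, L₀, hG⟩ := hWG (32 * A + 1) (by positivity) ε₁ hε₁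
  -- the order floor `s = a/2`
  obtain ⟨L₁, h₁⟩ := h (a / 2) (half_pos ha)
  -- a large even side
  obtain ⟨K, hKdef⟩ : ∃ K : ℕ, K = max L₀ L₁ + 1 := ⟨_, rfl⟩
  haveI : NeZero (2 * K) := ⟨by omega⟩
  have hK₀ : L₀ ≤ 2 * K := by omega
  have hK₁ : L₁ ≤ 2 * K := by omega
  have hE : Even (2 * K) := even_two_mul K
  obtain ⟨ψ, hψ1, hψ, hnoLRO, hshape⟩ := h₁ (2 * K) hK₁ hE
  have hgap := hG (2 * K) hK₀ hE
  -- the Goldstone shape bounds the window tail by `32 A ε L²`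
  have htail := windowSum_le_of_goldstoneShape (2 * K) hε.1 hε.2 hA ψ hshape
  have htail' : (∑ m : Fin 2 → ZMod (2 * K),
      if m ≠ 0 ∧ (2 * Real.pi / ((2 * K : ℕ) : ℝ)) ^ 2 *
          (∑ i : Fin 2, (((m i).valMinAbs : ℤ) : ℝ) ^ 2) ≤ ε ^ 2 then
        (star (Matrix.mulVec (pairFieldAt dWaveFormFactor (2 * K) m) ψ) ⬝ᵥ
            Matrix.mulVec (pairFieldAt dWaveFormFactor (2 * K) m) ψ).re / ((2 * K : ℕ) : ℝ) ^ 2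
      else 0) ≤ 32 * A * ε * ((2 * K : ℕ) : ℝ) ^ 2 := by
    convert htail using 2 with m
    exact if_congr Iff.rfl rfl rfl
  -- rewrite the gap in the shape `λ(σ + a')L²` with `σ = 32Aε`, `a' = ε + a`
  have hgap' : lam * (32 * A * ε + (ε + a)) * ((2 * K : ℕ) : ℝ) ^ 2 ≤
      (hubbardTorus 2 (2 * K) 1 U + (lam : ℂ) • (∑ m : Fin 2 → ZMod (2 * K),
          if (2 * Real.pi / ((2 * K : ℕ) : ℝ)) ^ 2 * (∑ i : Fin 2, (((m i).valMinAbs : ℤ) : ℝ) ^ 2) ≤ ε ^ 2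
          then (((2 * K : ℕ) : ℂ) ^ 2)⁻¹ • (Matrix.conjTranspose (pairFieldAt dWaveFormFactor (2 * K) m) *
            pairFieldAt dWaveFormFactor (2 * K) m)
          else 0)).minEnergyOn (szSector (2 * ⌊(1 - δ) * ((2 * K : ℕ) : ℝ) ^ 2 / 2⌋₊) 0) -
        (hubbardTorus 2 (2 * K) 1 U).minEnergyOn (szSector (2 * ⌊(1 - δ) * ((2 * K : ℕ) : ℝ) ^ 2 / 2⌋₊) 0) := by
    have : lam * (32 * A * ε + (ε + a)) * ((2 * K : ℕ) : ℝ) ^ 2 =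
        lam * ((32 * A + 1) * ε + a) * ((2 * K : ℕ) : ℝ) ^ 2 := by ring
    rw [this]
    exact hgap
  -- every-ground-state floor: `(ε + a) L⁴ ≤ Re ⟨ψ, Δ_dᴴ Δ_d ψ⟩ ≤ (a/2) L⁴`
  have hfloor := kacWindowPenalty_everyGS_floor (2 * K) U _ hlam hgap' hψ1 hψ htail'
  have hL : (1 : ℝ) ≤ ((2 * K : ℕ) : ℝ) := by
    have : 1 ≤ 2 * K := by omega
    exact_mod_cast this
  have hL4 : (1 : ℝ) ≤ ((2 * K : ℕ) : ℝ) ^ 4 := one_le_pow₀ hL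
  nlinarith [hfloor, hnoLRO, hε.1, ha, hL4]

/-- **Metallic special case: a BOUNDED pair structure factor on the punctured window plus no order
refutes the crux body at `(U, δ)`.** If for every `s > 0`, at all large even `L`, some normalised
sector ground state has `Re ⟨ψ, Δ_dᴴΔ_dψ⟩ ≤ sL⁴` and `S_ψ(m) ≤ B` for all `m ≠ 0` with `|q_m|² ≤ ε₁²`,
then the body of `WindowGap` at `(U, δ)` fails (Goldstone shape with `A = Bε₁`, since `|q_m| ≤ ε₁` on
the window). This is the calibration "a metal (flat pair structure factor, window weight `≈ κε²` per
site) fails the crux" in rigorous conditional form. Scalapino, Phys. Rep. 250 (1995) §2. [folklore] -/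
theorem not_windowGapAt_of_bddStructureFactor_of_noLRO {U δ B ε₁ : ℝ} (hB : 0 ≤ B) (hε₁ : 0 < ε₁)
    (h : ∀ s : ℝ, 0 < s → ∃ L₁ : ℕ, ∀ (L : ℕ) [NeZero L], L₁ ≤ L → Even L →
      ∃ ψ : Fock (Orb (FermionTorus 2 L)), star ψ ⬝ᵥ ψ = 1 ∧
        IsGroundStateInSector (hubbardTorus 2 L 1 U) (2 * ⌊(1 - δ) * (L : ℝ) ^ 2 / 2⌋₊) 0 ψ ∧
        (expect ((pairField dWaveFormFactor L)ᴴ * pairField dWaveFormFactor L) ψ).re ≤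
          s * (L : ℝ) ^ 4 ∧
        ∀ m : TorusSite 2 L, m ≠ 0 → momentumNormSq L m ≤ ε₁ ^ 2 →
          pairStructureFactor dWaveFormFactor L ψ m ≤ B) :
    ¬ ∀ C : ℝ, 0 ≤ C → ∀ ε₀ : ℝ, 0 < ε₀ → ∃ ε ∈ Set.Ioc (0 : ℝ) ε₀, ∃ lam a : ℝ, 0 < lam ∧ 0 < a ∧
      ∃ L₀ : ℕ, ∀ (L : ℕ) [NeZero L], L₀ ≤ L → Even L →
        lam * (C * ε + a) * (L : ℝ) ^ 2 ≤
          (hubbardTorus 2 L 1 U + (lam : ℂ) • (∑ m : Fin 2 → ZMod L,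
              if (2 * Real.pi / (L : ℝ)) ^ 2 * (∑ i : Fin 2, (((m i).valMinAbs : ℤ) : ℝ) ^ 2) ≤ ε ^ 2
              then ((L : ℂ) ^ 2)⁻¹ • (Matrix.conjTranspose (pairFieldAt dWaveFormFactor L m) *
                pairFieldAt dWaveFormFactor L m)
              else 0)).minEnergyOn (szSector (2 * ⌊(1 - δ) * (L : ℝ) ^ 2 / 2⌋₊) 0) -
            (hubbardTorus 2 L 1 U).minEnergyOn (szSector (2 * ⌊(1 - δ) * (L : ℝ) ^ 2 / 2⌋₊) 0) := by
  refine not_windowGapAt_of_goldstoneShape_of_noLRO (A := B * ε₁) (by positivity) hε₁ fun s hs => ?_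
  obtain ⟨L₁, h₁⟩ := h s hs
  refine ⟨L₁, fun L _ hL hE => ?_⟩
  obtain ⟨ψ, hψ1, hψ, hno, hbdd⟩ := h₁ L hL hE
  refine ⟨ψ, hψ1, hψ, hno, fun m hm0 hm => ?_⟩
  have hS := hbdd m hm0 hm
  have hq : Real.sqrt (momentumNormSq L m) ≤ ε₁ := by
    rw [← Real.sqrt_sq hε₁.le]
    exact Real.sqrt_le_sqrt hm
  have hS0 : 0 ≤ pairStructureFactor dWaveFormFactor L ψ m := pairStructureFactor_nonneg _ _ _ _
  calc pairStructureFactor dWaveFormFactor L ψ m * Real.sqrt (momentumNormSq L m)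
      ≤ B * ε₁ := mul_le_mul hS hq (Real.sqrt_nonneg _) hB

/-- **What `¬ WindowGap` asks of a refuter.** If at EVERY `U > 0`, `δ ∈ (0, 1/2)` there are `A ≥ 0`,
`ε₁ > 0` such that for every order floor `s > 0`, at all large even `L`, some normalised
`(N_L, S^z = 0)`-sector ground state of the pure Hubbard torus has neither `d`-wave pair order at level
`s` (`Re ⟨ψ, Δ_dᴴΔ_dψ⟩ ≤ sL⁴`) nor a super-Goldstone pair singularity on the punctured window
(`S_ψ(m)|q_m| ≤ A`, `0 < |q_m| ≤ ε₁`), then the crux `WindowGap` is false. Equivalently, `WindowGap`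
asserts that at some `(U, δ)` every ground-state sequence shows, uniformly often in `L`, `d`-wave pair
order OR a pair structure factor more singular than `1/|q|` at small momenta — the rigorous content of
"the crux contains superconducting pair correlations". Neither hypothesis is a theorem at any `U > 0`
today (the crux is open both ways). Scalapino, Phys. Rep. 250 (1995) §2; Kennedy–Lieb–Shastry, PRL 61
(1988) 2582. [folklore] -/
theorem not_windowGap_of_forall_goldstoneShape_noLRO
    (h : ∀ U : ℝ, 0 < U → ∀ δ ∈ Set.Ioo (0 : ℝ) (1 / 2), ∃ A ε₁ : ℝ, 0 ≤ A ∧ 0 < ε₁ ∧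
      ∀ s : ℝ, 0 < s → ∃ L₁ : ℕ, ∀ (L : ℕ) [NeZero L], L₁ ≤ L → Even L →
        ∃ ψ : Fock (Orb (FermionTorus 2 L)), star ψ ⬝ᵥ ψ = 1 ∧
          IsGroundStateInSector (hubbardTorus 2 L 1 U) (2 * ⌊(1 - δ) * (L : ℝ) ^ 2 / 2⌋₊) 0 ψ ∧
          (expect ((pairField dWaveFormFactor L)ᴴ * pairField dWaveFormFactor L) ψ).re ≤
            s * (L : ℝ) ^ 4 ∧
          ∀ m : TorusSite 2 L, m ≠ 0 → momentumNormSq L m ≤ ε₁ ^ 2 →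
            pairStructureFactor dWaveFormFactor L ψ m * Real.sqrt (momentumNormSq L m) ≤ A) :
    ¬ WindowGap := by
  rintro ⟨U, hU, δ, hδ, hG⟩
  obtain ⟨A, ε₁, hA, hε₁, hh⟩ := h U hU δ hδ
  exact not_windowGapAt_of_goldstoneShape_of_noLRO hA hε₁ hh hG

/-- **Metallic form of the refuter's task.** If at EVERY `U > 0`, `δ ∈ (0, 1/2)` some `B ≥ 0`,
`ε₁ > 0` bound the pair structure factor, `S_ψ(m) ≤ B` for `0 < |q_m| ≤ ε₁`, of SOME normalised
sector ground state without `d`-wave pair order at every level `s > 0` (all large even `L`), then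
`WindowGap` is false (`not_windowGapAt_of_bddStructureFactor_of_noLRO` at the crux's `(U, δ)`).
"The pure Hubbard model is a `d`-wave-pair metal at every coupling and doping" — unproved at every
`U > 0` — would thus refute the crux. Scalapino, Phys. Rep. 250 (1995) §2. [folklore] -/
theorem not_windowGap_of_forall_bddStructureFactor_noLRO
    (h : ∀ U : ℝ, 0 < U → ∀ δ ∈ Set.Ioo (0 : ℝ) (1 / 2), ∃ B ε₁ : ℝ, 0 ≤ B ∧ 0 < ε₁ ∧
      ∀ s : ℝ, 0 < s → ∃ L₁ : ℕ, ∀ (L : ℕ) [NeZero L], L₁ ≤ L → Even L →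
        ∃ ψ : Fock (Orb (FermionTorus 2 L)), star ψ ⬝ᵥ ψ = 1 ∧
          IsGroundStateInSector (hubbardTorus 2 L 1 U) (2 * ⌊(1 - δ) * (L : ℝ) ^ 2 / 2⌋₊) 0 ψ ∧
          (expect ((pairField dWaveFormFactor L)ᴴ * pairField dWaveFormFactor L) ψ).re ≤
            s * (L : ℝ) ^ 4 ∧
          ∀ m : TorusSite 2 L, m ≠ 0 → momentumNormSq L m ≤ ε₁ ^ 2 →
            pairStructureFactor dWaveFormFactor L ψ m ≤ B) :
    ¬ WindowGap := by
  rintro ⟨U, hU, δ, hδ, hG⟩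
  obtain ⟨B, ε₁, hB, hε₁, hh⟩ := h U hU δ hδ
  exact not_windowGapAt_of_bddStructureFactor_of_noLRO hB hε₁ hh hG

end Summit.HubbardSuperconductivity.HubbardSuperconductivity.Theorems.WindowGap.Negative
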